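import Summits.Ventures.CertifiedQuantumChemistry.Rows.CIUpperBound
import HarnessLib

/-!
# Ventures/CertifiedQuantumChemistry — Rows/CIEnergySymmetric.lean: the CI Rayleigh numerator over the UPPER TRIANGLE, with cheap guards (a faster kernel feed for `Rows/CIUpperBound.lean`'s certificates)

HONEST FRAMING (verbatim): certified bounds for a stated model Hamiltonian in a stated basis; not a
claim about the real molecule beyond that model.

var-2 (gen 14), zero compute, PROVED glue only (0 sorry, no definition, no claim node; nothing here asserts a
bound about any model). `Rows/CIUpperBound.lean` (typer) feeds the kernel the CI Rayleigh numerator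
`CIVec.energy F ψ = Σ_i Σ_j c_i c_j ⟨D_i|H_F|D_j⟩` row by row, i.e. all `n²` Slater–Condon evaluations. For a
SYMMETRIC model the mirror is symmetric, `F.slaterCondon I J = F.slaterCondon J I`
(`Model.slaterCondon_comm`: the bridge `hamiltonian_apply_eq_slaterCondon` + Hermiticity of `H_F` + reality of a
rational), so the numerator is the diagonal plus TWICE the strict upper triangle
(`CIVec.energy_eq_diag_add_two_mul_upper`), and per-row bounds on
`c_i² ⟨D_i|H_F|D_i⟩ + 2 Σ_{j>i} c_i c_j ⟨D_i|H_F|D_j⟩` with `Σ_i r_i ≤ c` give `energy F ψ ≤ c`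
(`CIVec.energy_le_of_upperRows`; the `if i < j` guard is decided before the matrix element, so the kernel
evaluates `n(n+1)/2` elements instead of `n²`). Entry points `CIVec.upperCertificate_of_upperRows` /
`CIVec.upperRow_of_upperRows` mirror the typer's `upperCertificate` / `upperRow_of_rows`. Also the norm on
DISTINCT determinants, `CIVec.normSq_eq_sum_sq_of_injective` (`⟨ψ,ψ⟩ = Σ_i c_i²`), with distinctness read off a
strictly increasing integer code along the list (`CIVec.det_injective_of_code_lt_succ`: `n − 1` comparisons in
the kernel instead of the `n²` occupation-set equalities of `CIVec.normSq`), and `Model.eq_of_forall_apply`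
(two models with equal integral values are equal — to re-table a literal model with constant-time indexing before a
large kernel evaluation). Finally the GUARDED feed for vectors given by `α`/`β` strings
(`|α↑ β↓⟩ = pairSet α β`): a pair with more than two replacements, `#(α_j ∖ α_i) + #(β_j ∖ β_i) > 2` — decided on the
small spatial sets before any matrix element (`card_pairSet_sdiff_pairSet`,
`Model.slaterCondon_eq_zero_of_two_lt_card_sdiff`) — contributes `0` and is skipped
(`CIVec.sum_upper_eq_sum_upper_guard`; entry points `CIVec.upperCertificate_of_guardedRows` /
`CIVec.upperRow_of_guardedRows`). Measured on the farm (k = 6, n = 200): ≈ 40 ms per surviving pair, ≈ 1 ms per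
skipped pair, against ≈ 25 + 20 ms per pair for the unguarded `![…]`-indexed feed. First use:
`Certificates/H6Sto6gR1786KernelUpper.lean` (200 determinants).
-/

namespace Summit.Ventures.CertifiedQuantumChemistry

open Matrix Finset
open Literature.MathematicalPhysics.QuantumLattice Literature.MathematicalPhysics.QuantumChemistry

namespace Model

variable {k : ℕ}

/-- For a symmetric model the kernel's Slater–Condon mirror is a symmetric matrix:
`⟨I|H_F|J⟩ = ⟨J|H_F|I⟩` (both are real rationals and `H_F` is Hermitian). -/
theorem slaterCondon_comm {F : Model k} (hF : F.IsSymmetric) (I J : Finset (Orb (Fin k))) :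
    F.slaterCondon I J = F.slaterCondon J I := by
  have h := (Model.hamiltonian_isHermitian hF).apply I J
  rw [hamiltonian_apply_eq_slaterCondon, hamiltonian_apply_eq_slaterCondon, Complex.star_def,
    map_ratCast] at h
  exact_mod_cast h.symm

/-- Two models with the same integrals and the same `E_core` are equal (used to RE-TABLE a literal model for
fast kernel evaluation: prove the entries agree by `decide`, then rewrite). -/
theorem eq_of_forall_apply {F G : Model k} (hh : ∀ p q, F.h p q = G.h p q)
    (he : ∀ p q r s, F.eri p q r s = G.eri p q r s) (hc : F.ecore = G.ecore) : F = G := by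
  obtain ⟨h₁, e₁, c₁⟩ := F
  obtain ⟨h₂, e₂, c₂⟩ := G
  obtain rfl : h₁ = h₂ := funext fun p => funext fun q => hh p q
  obtain rfl : e₁ = e₂ := funext fun p => funext fun q => funext fun r => funext fun s => he p q r s
  obtain rfl : c₁ = c₂ := hc
  rfl

end Model

namespace CIVec

variable {k n : ℕ}

/-- A symmetric double sum over `Fin n × Fin n` is its diagonal plus twice its strict upper triangle. -/
theorem sum_sum_eq_diag_add_two_mul_upper (f : Fin n → Fin n → ℚ) (hsym : ∀ i j, f i j = f j i) :
    ∑ i, ∑ j, f i j = ∑ i, (f i i + 2 * ∑ j, if i < j then f i j else 0) := by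
  have htri : ∀ i j, f i j =
      (if i < j then f i j else 0) + ((if j < i then f i j else 0) + (if j = i then f i j else 0)) := by
    intro i j
    rcases lt_trichotomy i j with h | h | h
    · rw [if_pos h, if_neg (lt_asymm h), if_neg (ne_of_gt h), add_zero, add_zero]
    · subst h
      rw [if_neg (lt_irrefl _), if_pos rfl, zero_add, zero_add]
    · rw [if_neg (lt_asymm h), if_pos h, if_neg (ne_of_lt h), zero_add, add_zero]
  have hlow : ∑ i, ∑ j, (if j < i then f i j else 0) = ∑ i, ∑ j, (if i < j then f i j else 0) := by
    rw [Finset.sum_comm]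
    refine Finset.sum_congr rfl fun i _ => Finset.sum_congr rfl fun j _ => ?_
    split_ifs with h
    · exact hsym j i
    · rfl
  have hdiag : ∀ i, ∑ j, (if j = i then f i j else 0) = f i i := fun i => by
    rw [Finset.sum_ite_eq' Finset.univ i (fun j => f i j), if_pos (Finset.mem_univ i)]
  calc ∑ i, ∑ j, f i j
      = ∑ i, ∑ j, ((if i < j then f i j else 0) +
          ((if j < i then f i j else 0) + (if j = i then f i j else 0))) :=
        Finset.sum_congr rfl fun i _ => Finset.sum_congr rfl fun j _ => htri i j
    _ = ∑ i, ∑ j, (if i < j then f i j else 0) +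
          (∑ i, ∑ j, (if j < i then f i j else 0) + ∑ i, ∑ j, (if j = i then f i j else 0)) := by
        simp only [Finset.sum_add_distrib]
    _ = ∑ i, (f i i + 2 * ∑ j, if i < j then f i j else 0) := by
        rw [hlow, Finset.sum_congr rfl fun i _ => hdiag i, Finset.sum_add_distrib, ← Finset.mul_sum]
        ring

/-- **Upper-triangle form of the CI Rayleigh numerator** for a symmetric model:
`Σ_ij c_i c_j ⟨D_i|H_F|D_j⟩ = Σ_i (c_i² ⟨D_i|H_F|D_i⟩ + 2 Σ_{j>i} c_i c_j ⟨D_i|H_F|D_j⟩)`. -/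
theorem energy_eq_diag_add_two_mul_upper {F : Model k} (hF : F.IsSymmetric) (ψ : CIVec k n) :
    ψ.energy F = ∑ i, (ψ.coeff i * ψ.coeff i * F.slaterCondon (ψ.det i) (ψ.det i) +
      2 * ∑ j, if i < j then ψ.coeff i * ψ.coeff j * F.slaterCondon (ψ.det i) (ψ.det j) else 0) := by
  unfold energy
  exact sum_sum_eq_diag_add_two_mul_upper _ fun i j => by
    rw [Model.slaterCondon_comm hF (ψ.det i) (ψ.det j), mul_comm (ψ.coeff i) (ψ.coeff j)]

/-- Row-by-row feeding over the upper triangle: per-row bounds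
`c_i² ⟨D_i|H_F|D_i⟩ + 2 Σ_{j>i} c_i c_j ⟨D_i|H_F|D_j⟩ ≤ r_i` and `Σ_i r_i ≤ c` give `energy F ψ ≤ c`
(symmetric model; one `decide` per row evaluates `n − i` matrix elements). -/
theorem energy_le_of_upperRows {F : Model k} (hF : F.IsSymmetric) (ψ : CIVec k n) (r : Fin n → ℚ) {c : ℚ}
    (hrow : ∀ i, ψ.coeff i * ψ.coeff i * F.slaterCondon (ψ.det i) (ψ.det i) +
      2 * (∑ j, if i < j then ψ.coeff i * ψ.coeff j * F.slaterCondon (ψ.det i) (ψ.det j) else 0) ≤ r i)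
    (hsum : ∑ i, r i ≤ c) : ψ.energy F ≤ c := by
  rw [energy_eq_diag_add_two_mul_upper hF]
  exact (Finset.sum_le_sum fun i _ => hrow i).trans hsum

/-- **Kernel entry point (certificate form)**: sector purity, positive norm, the upper-triangle row bounds
and `Σ_i r_i ≤ hi · normSq` give `UpperCertificate F a b hi` for a symmetric model. -/
theorem upperCertificate_of_upperRows {F : Model k} (hF : F.IsSymmetric) (ψ : CIVec k n) (r : Fin n → ℚ)
    {a b : ℕ} {hi : ℚ} (hsec : ψ.InSector a b) (hpos : 0 < ψ.normSq)
    (hrow : ∀ i, ψ.coeff i * ψ.coeff i * F.slaterCondon (ψ.det i) (ψ.det i) +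
      2 * (∑ j, if i < j then ψ.coeff i * ψ.coeff j * F.slaterCondon (ψ.det i) (ψ.det j) else 0) ≤ r i)
    (hsum : ∑ i, r i ≤ hi * ψ.normSq) : UpperCertificate F a b hi :=
  upperCertificate F ψ hsec hpos (energy_le_of_upperRows hF ψ r hrow hsum)

/-- **Kernel entry point (row form)**: the same data give `UpperRow F a b hi`. -/
theorem upperRow_of_upperRows {F : Model k} (hF : F.IsSymmetric) (ψ : CIVec k n) (r : Fin n → ℚ)
    {a b : ℕ} {hi : ℚ} (hsec : ψ.InSector a b) (hpos : 0 < ψ.normSq)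
    (hrow : ∀ i, ψ.coeff i * ψ.coeff i * F.slaterCondon (ψ.det i) (ψ.det i) +
      2 * (∑ j, if i < j then ψ.coeff i * ψ.coeff j * F.slaterCondon (ψ.det i) (ψ.det j) else 0) ≤ r i)
    (hsum : ∑ i, r i ≤ hi * ψ.normSq) : UpperRow F a b hi :=
  upperRow_of_certificate hF (upperCertificate_of_upperRows hF ψ r hsec hpos hrow hsum)

/-! ### The norm of a vector on DISTINCT determinants (an `O(n)` kernel check instead of `n²` set equalities) -/

/-- On pairwise distinct determinants `⟨ψ,ψ⟩ = Σ_i c_i²`. -/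
theorem normSq_eq_sum_sq_of_injective (ψ : CIVec k n) (h : Function.Injective ψ.det) :
    ψ.normSq = ∑ i, ψ.coeff i * ψ.coeff i := by
  unfold normSq
  refine Finset.sum_congr rfl fun i _ => ?_
  have hc : ∀ j, (if ψ.det i = ψ.det j then ψ.coeff i * ψ.coeff j else 0) =
      if i = j then ψ.coeff i * ψ.coeff j else 0 := fun j => by
    by_cases hij : i = j
    · rw [if_pos hij, if_pos (congrArg ψ.det hij)]
    · rw [if_neg hij, if_neg fun e => hij (h e)]
  rw [Finset.sum_congr rfl fun j _ => hc j, Finset.sum_ite_eq Finset.univ i, if_pos (Finset.mem_univ i)]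

/-- Distinctness from a STRICTLY INCREASING integer code along the list (one comparison per consecutive
pair: order the determinants by any injective code, e.g. the occupation bit mask, before writing the
vector). -/
theorem det_injective_of_code_lt_succ {m : ℕ} (ψ : CIVec k (m + 1)) (g : Finset (Orb (Fin k)) → ℕ)
    (h : ∀ i : Fin m, g (ψ.det (Fin.castSucc i)) < g (ψ.det i.succ)) : Function.Injective ψ.det := by
  have hmono : StrictMono (g ∘ ψ.det) := Fin.strictMono_iff_lt_succ.2 h
  intro i j hij
  exact hmono.injective (show (g ∘ ψ.det) i = (g ∘ ψ.det) j by simp only [Function.comp_apply, hij])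

/-! ### Skipping far pairs cheaply: more than two replacements ⇒ the matrix element vanishes -/

/-- More than two replacements (`#(J ∖ I) > 2`) ⇒ `⟨I|H_F|J⟩ = 0` (the `otherwise 0` branch of `Model.slaterCondon`). -/
theorem _root_.Summit.Ventures.CertifiedQuantumChemistry.Model.slaterCondon_eq_zero_of_two_lt_card_sdiff
    (F : Model k) {I J : Finset (Orb (Fin k))} (h : 2 < (J \ I).card) : F.slaterCondon I J = 0 := by
  unfold Model.slaterCondon
  have hne : I ≠ J := by
    rintro rfl
    simp at h
  rw [if_neg hne, if_neg (fun h1 => by omega), dif_neg (fun h3 => by omega)]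

/-- Occupation-set difference of two `α↑ ∪ β↓` configurations, spin by spin. -/
theorem pairSet_sdiff_pairSet {Λ : Type*} [LinearOrder Λ] [Fintype Λ] (α β α' β' : Finset Λ) :
    pairSet α β \ pairSet α' β' = pairSet (α \ α') (β \ β') := by
  ext i
  simp only [Finset.mem_sdiff, mem_pairSet]
  rcases orb_cases i with h | h <;> rw [h] <;> simp

/-- `#(α↑ ∪ β↓ ∖ α'↑ ∪ β'↓) = #(α ∖ α') + #(β ∖ β')`. -/
theorem card_pairSet_sdiff_pairSet {Λ : Type*} [LinearOrder Λ] [Fintype Λ] (α β α' β' : Finset Λ) :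
    (pairSet α β \ pairSet α' β').card = (α \ α').card + (β \ β').card := by
  rw [pairSet_sdiff_pairSet, card_pairSet]

/-- The upper-triangle row sum with a CHEAP GUARD: for determinants given by their `α`/`β` strings, a pair with
more than two replacements (`#(α_j ∖ α_i) + #(β_j ∖ β_i) > 2`, decided on the small spatial-orbital sets BEFORE the
matrix element) contributes `0`, so it may be skipped. -/
theorem sum_upper_eq_sum_upper_guard (F : Model k) (A B : Fin n → Finset (Fin k)) (c : Fin n → ℚ) (i : Fin n) :
    (∑ j, if i < j then c i * c j * F.slaterCondon (pairSet (A i) (B i)) (pairSet (A j) (B j)) else 0) =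
      ∑ j, if i < j ∧ (A j \ A i).card + (B j \ B i).card ≤ 2 then
        c i * c j * F.slaterCondon (pairSet (A i) (B i)) (pairSet (A j) (B j)) else 0 := by
  refine Finset.sum_congr rfl fun j _ => ?_
  by_cases hij : i < j
  · by_cases hg : (A j \ A i).card + (B j \ B i).card ≤ 2
    · rw [if_pos hij, if_pos ⟨hij, hg⟩]
    · rw [if_pos hij, if_neg (fun h => hg h.2), Model.slaterCondon_eq_zero_of_two_lt_card_sdiff, mul_zero]
      rw [card_pairSet_sdiff_pairSet]
      omega
  · rw [if_neg hij, if_neg (fun h => hij h.1)]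

/-- **Kernel entry point (certificate form, `α`/`β`-string data, guarded upper-triangle feed).** For the vector
`Σ_i c_i |α_i↑ β_i↓⟩`: sector purity, positive norm, the guarded row bounds
`c_i² ⟨D_i|H|D_i⟩ + 2 Σ_{j>i, ≤ 2 replacements} c_i c_j ⟨D_i|H|D_j⟩ ≤ r_i` and `Σ_i r_i ≤ hi · ⟨ψ,ψ⟩` give
`UpperCertificate F a b hi` (symmetric model). -/
theorem upperCertificate_of_guardedRows {F : Model k} (hF : F.IsSymmetric) (A B : Fin n → Finset (Fin k))
    (c r : Fin n → ℚ) {a b : ℕ} {hi : ℚ}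
    (hsec : (⟨fun i => pairSet (A i) (B i), c⟩ : CIVec k n).InSector a b)
    (hpos : 0 < (⟨fun i => pairSet (A i) (B i), c⟩ : CIVec k n).normSq)
    (hrow : ∀ i, c i * c i * F.slaterCondon (pairSet (A i) (B i)) (pairSet (A i) (B i)) +
      2 * (∑ j, if i < j ∧ (A j \ A i).card + (B j \ B i).card ≤ 2 then
        c i * c j * F.slaterCondon (pairSet (A i) (B i)) (pairSet (A j) (B j)) else 0) ≤ r i)
    (hsum : ∑ i, r i ≤ hi * (⟨fun i => pairSet (A i) (B i), c⟩ : CIVec k n).normSq) :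
    UpperCertificate F a b hi :=
  upperCertificate_of_upperRows hF _ r hsec hpos
    (fun i => by
      have h := hrow i
      rw [← sum_upper_eq_sum_upper_guard] at h
      exact h) hsum

/-- **Kernel entry point (row form, `α`/`β`-string data, guarded upper-triangle feed)**: the same data give
`UpperRow F a b hi`. -/
theorem upperRow_of_guardedRows {F : Model k} (hF : F.IsSymmetric) (A B : Fin n → Finset (Fin k))
    (c r : Fin n → ℚ) {a b : ℕ} {hi : ℚ}
    (hsec : (⟨fun i => pairSet (A i) (B i), c⟩ : CIVec k n).InSector a b)
    (hpos : 0 < (⟨fun i => pairSet (A i) (B i), c⟩ : CIVec k n).normSq)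
    (hrow : ∀ i, c i * c i * F.slaterCondon (pairSet (A i) (B i)) (pairSet (A i) (B i)) +
      2 * (∑ j, if i < j ∧ (A j \ A i).card + (B j \ B i).card ≤ 2 then
        c i * c j * F.slaterCondon (pairSet (A i) (B i)) (pairSet (A j) (B j)) else 0) ≤ r i)
    (hsum : ∑ i, r i ≤ hi * (⟨fun i => pairSet (A i) (B i), c⟩ : CIVec k n).normSq) :
    UpperRow F a b hi :=
  upperRow_of_certificate hF (upperCertificate_of_guardedRows hF A B c r hsec hpos hrow hsum)

end CIVec

end Summit.Ventures.CertifiedQuantumChemistry
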